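import Literature.NumberTheory.EllipticCurves.DivisionPointsLaneCoherence
import Literature.NumberTheory.EllipticCurves.FormalGroupPadicIntEndomorphisms
import Literature.NumberTheory.GaloisRepresentations.LubinTateComparisonDilation
import HarnessLib

/-!
# TATE-UNIT-CM inputs: `[c]_{P′} z(ξ(u′)) = z(ξ(δu′))` on the lane curve for a `v`-adic UNIT multiplier `δ`
# (the CM-formal half of the Tate-unit transport across levels; de Shalit II.1.10 / II.4.4 (iv) — proofs only)

Topic `NumberTheory/EllipticCurves` (theorems only; no definition, no named fact, no instance).  Cell `bsd-print-cf2`, width seat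
`bsd-line-cf2c-w4` g16, piece TATE-UNIT-CM of OQ-A1 (the level-independence of the seam's period constant
`A_M = θ(a_M)·ι⁻¹(w₀ μ_M)`): the division points of two levels are related by the ALGEBRAIC CM action of `δ = μ_{M′}/μ_M`
(`u_{n+1}(M) ≡ δ·u_{n+1}(M′) (mod Λ_W)`, §3), and on `E₁` that action IS the Lubin–Tate endomorphism `[e(δ)]_{P′}` on parameters —
this file proves the latter from the cell's chart machinery, for a GENERAL scalar:

* §1 `hom_eq_of_map_eq_of_map_eq` — **`[c]_{[π]} = [c]_ℤ`**: for the lane's Lubin–Tate series `P = [π] = exp_W(π·log_W)` over `ℤ_p`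
  (`hPexp`) and any integral lift `Pc` of `exp_W(c·log_W)`, `LubinTate.hom hA hP hP c = Pc` (uniqueness `LubinTate.eq_hom` +
  `[π] ∘ [c] = [πc] = [c] ∘ [π]`, `FormalGroupPadicIntEndomorphisms.subst_of_map_eq`) — `OrdinaryFormalGroupLubinTateModule.hom_eq_of_map_eq`
  for an ABSTRACT Lubin–Tate datum `(hA, hP)`;
* §2 ★★★ `ltSMul_zPt_eq_zPt_of_readings_of_hom` — ON THE LANE CURVE over one level `M′`: for kernel points `U′ = ι_vξ(u′)`, `U = ι_vξ(u)`
  with `α·u′ ≡ u (mod Λ)` (`α = ι̂(j α_R)` the complex reading of the multiplier), the formal CM action `T_R` reading `[c]_{P′}`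
  (`T_R ⊗_ψ 𝒪 = [c]_{P′} ⊗ 𝒪`), the base points `ξ(Ω₁)`, `ξ(αΩ₁)`, the transformation pair of `α` with its `R`-lifts and the series
  identities `hidX`/`hidY`, the auxiliary readings `ξ(Ω₁ + u′)`, `ξ(α(Ω₁ + u′))`, and `[c]_{P′} z(U′) ≠ 0`:
  **`[c]_{P′} z(U′) = z(U)`** — `DivisionPointsLaneCoherence.ltSMul_zPt_eq_inclPt_zPt_of_readings` with `[π]_{P′}` replaced by `[c]_{P′}`
  (`CMFormalActionLaneCoherence.ptOfZ_ltSMul_eq_sub_of_cm_identities_of_hom`) and both points at the same level;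
* §3 `divisionPt_sub_mul_divisionPt_mem` — **`u_n(Ω) − ι(δ)·u_n(Ω′) ∈ L`** for `Ω = ι(δ)Ω′`, `L = Ω·ι(𝔪) = Ω′·ι(𝔪′)`, `𝔪′ ≤ 𝔪`,
  `βπ₀ ≡ 1 (𝔪)`, `β′π₀ ≡ 1 (𝔪′)` (`u_n(Ω) = ι(βⁿ)Ω − Ω/ι(π₀ⁿ)`): de Shalit's division points of two moduli differ by the CM action of `δ`.

No summit statement is proved; BSD is not proved by any of this.

## References
* [deShalit1987] E. de Shalit, *Iwasawa theory of elliptic curves with complex multiplication* (1987), I §1.2, II §1.10 Lemma (p. 39),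
  II §4.4 (iv) (p. 57–58), II §4.9 Proposition (ii).
* [LubinTate1965] J. Lubin, J. Tate, *Formal complex multiplication in local fields* (1965), §1 Thm. 1, (5), (11).
* [SilvermanAEC2009] J. H. Silverman, *The Arithmetic of Elliptic Curves*, 2nd ed. (2009), IV.2.3, VII.2.2.
-/

noncomputable section

open scoped Classical PeriodPair
open Polynomial

namespace Literature.NumberTheory.EllipticCurves

open ValuativeRel Literature.NumberTheory.GaloisRepresentations
  Literature.NumberTheory.GaloisRepresentations.IsNonarchimedeanLocalField
  Literature.NumberTheory.GaloisRepresentations.LubinTate Field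
open Literature.NumberTheory.EllipticCurves.FormalGroupChart _root_.WeierstrassCurve _root_.PeriodPair

/-! ## §1 `[c]_{[π]} = [c]_ℤ = exp_W(c·log_W)` for an abstract Lubin–Tate datum over `ℤ_p` -/

section Hom

variable {p : ℕ} [Fact p.Prime] (V : WeierstrassCurve ℤ_[p])

/-- **`[c]_{[π]} = [c]_ℤ`**: if `P ∈ 𝔉_π` over `(ℤ_p, π, q)` is the integral lift of `exp_W(π·log_W)` (`W = V ⊗ ℚ_p`) and `Pc` that of
`exp_W(c·log_W)`, then `LubinTate.hom hA hP hP c = Pc` (both `≡ cX`, both commute with `P`: `[π] ∘ [c] = [πc] = [c] ∘ [π]`).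
[cite: LubinTate1965, §1 Thm. 1 (5), (11)] [cite: SilvermanAEC2009, IV.2.3] -/
theorem hom_eq_of_map_eq_of_map_eq {π : ℤ_[p]} {q : ℕ} (hA : IsLTRing π q) {P : PowerSeries ℤ_[p]} (hP : IsLTSeries π q P)
    (hPexp : P.map PadicInt.Coe.ringHom =
      (V.map PadicInt.Coe.ringHom).formalExp.subst (PowerSeries.C (π : ℚ_[p]) * (V.map PadicInt.Coe.ringHom).formalLog))
    {c : ℤ_[p]} {Pc : PowerSeries ℤ_[p]} (hPc : Pc.map PadicInt.Coe.ringHom =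
      (V.map PadicInt.Coe.ringHom).formalExp.subst (PowerSeries.C (c : ℚ_[p]) * (V.map PadicInt.Coe.ringHom).formalLog)) :
    hom hA hP hP c = Pc := by
  symm
  obtain ⟨T, hT⟩ := V.exists_map_eq_formalExp_subst_C_mul_formalLog (π * c)
  have hT' : T.map PadicInt.Coe.ringHom = (V.map PadicInt.Coe.ringHom).formalExp.subst
      (PowerSeries.C ((c * π : ℤ_[p]) : ℚ_[p]) * (V.map PadicInt.Coe.ringHom).formalLog) := by
    rw [mul_comm c π]; exact hT
  refine eq_hom _ _ _ (constantCoeff_eq_zero_of_map_eq hPc) (coeff_one_eq_of_map_eq hPc) ?_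
  rw [subst_of_map_eq hPexp hPc hT, subst_of_map_eq hPc hPexp hT']

end Hom

/-! ## §2 `[c]_{P′} z(U′) = z(U)` on the lane curve, from readings -/

section Transport

variable {F : Type} [Field F] [ValuativeRel F] [TopologicalSpace F] [IsNonarchimedeanLocalField F]

attribute [local instance] ltNormUniformSpace ltNormIsUniformAddGroup rk1 nF nE fintypeResidueField

variable {p : ℕ} [Fact p.Prime] (e : 𝒪[F] ≃+* ℤ_[p]) (hq : residueFieldCard F = p)
  {π : 𝒪[F]} (hπ : (valuation F).IsUniformizer (π : F)) {πZ : ℤ_[p]} (he : e π = πZ)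
  {P : PowerSeries ℤ_[p]} (hP : IsLTSeries πZ p P) (W : WeierstrassCurve ℤ)
  (M' : IntermediateField F (AlgebraicClosure F)) [FiniteDimensional F M']
  [hEll' : (curveOver M' ((W.map (Int.castRingHom ℤ_[p])).map ((LTCoeff.of F).toRingHom.comp e.symm.toRingHom))).IsElliptic]
  {Kb : Type*} [Field Kb] (ιc : Kb →+* ℂ) (ιv : Kb →+* AlgebraicClosure F)
  {R : Type*} [CommRing R] (ψ : R →+* unitBall M') (j : R →+* Kb)
  (hψj : ∀ r : R, ((((ψ r : unitBall M') : M') : AlgebraicClosure F)) = ιv (j r))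
  (L : PeriodPair) (h₂ : L.g₂ = (W.baseChange ℂ).c₄ / 12) (h₃ : L.g₃ = (W.baseChange ℂ).c₆ / 216)

include hq he hψj h₂ h₃ in
set_option maxHeartbeats 1600000 in
/-- ★★★ **`[c]_{P′} z(U′) = z(U)` from readings** (see the module docstring): the twin of
`ltSMul_zPt_eq_inclPt_zPt_of_readings` for a GENERAL scalar `c` (the formal CM action `T_R` reads `[c]_{P′}`, hypothesis `hTP`) and
both points `U = ι_vξ(u)`, `U′ = ι_vξ(u′)` at the same level `M′`, `α·u′ ≡ u (mod Λ)`; the non-vanishing `[c]_{P′} z(U′) ≠ 0` is a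
hypothesis (`hs0`; automatic for a unit `c`). [cite: deShalit1987, II §1.10, II §4.4 (iv), II §4.9 Proposition (ii)]
[cite: SilvermanAEC2009, III.2.3, VII.2.2] -/
theorem ltSMul_zPt_eq_zPt_of_readings_of_hom
    -- the CM datum over `R` and its complex reading
    {αR : R} {PC QC : ℂ[X]}
    (hT : ∀ z : ℂ, z ∉ L.lattice → ιc (j αR) * z ∉ L.lattice → PC.eval (℘[L] z) = ℘[L] (ιc (j αR) * z) * QC.eval (℘[L] z))
    {Pr Qr : R[X]} {s : ℂ} (hs : s ≠ 0)
    (hQr : Qr.map (ιc.comp j) = C s * QC.comp (X + C ((W.baseChange ℂ).b₂ / 12)))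
    (hPr : Pr.map (ιc.comp j) = C s * (PC.comp (X + C ((W.baseChange ℂ).b₂ / 12)) -
      C ((W.baseChange ℂ).b₂ / 12) * QC.comp (X + C ((W.baseChange ℂ).b₂ / 12))))
    (c : LTCoeff F) {T : PowerSeries R} (hT0 : PowerSeries.constantCoeff T = 0)
    (hTP : T.map ψ = (hom (isLTRing_LTCoeff hπ) (isLTSeries_map_LTCoeff_of_degree_one e hq he hP)
      (isLTSeries_map_LTCoeff_of_degree_one e hq he hP) c).map (algebraMap (LTCoeff F) (unitBall M')))
    {x₀ y₀ x₁ y₁ : R}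
    (hidX : (((W.map (Int.castRingHom R)).translateX x₁ y₁).subst T + PowerSeries.C (0 : R)) *
        Polynomial.aeval ((W.map (Int.castRingHom R)).translateX x₀ y₀ + PowerSeries.C (0 : R)) Qr =
      Polynomial.aeval ((W.map (Int.castRingHom R)).translateX x₀ y₀ + PowerSeries.C (0 : R)) Pr)
    (hidY : PowerSeries.C αR * (2 * PowerSeries.subst T ((W.map (Int.castRingHom R)).translateY x₁ y₁) +
            PowerSeries.C (W.map (Int.castRingHom R)).a₁ * PowerSeries.subst T ((W.map (Int.castRingHom R)).translateX x₁ y₁) +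
            PowerSeries.C (W.map (Int.castRingHom R)).a₃) *
          Polynomial.aeval ((W.map (Int.castRingHom R)).translateX x₀ y₀ + PowerSeries.C (0 : R)) Qr +
        (PowerSeries.subst T ((W.map (Int.castRingHom R)).translateX x₁ y₁) + PowerSeries.C (0 : R)) *
          Polynomial.aeval ((W.map (Int.castRingHom R)).translateX x₀ y₀ + PowerSeries.C (0 : R)) (Polynomial.derivative Qr) *
          (2 * (W.map (Int.castRingHom R)).translateY x₀ y₀ +
            PowerSeries.C (W.map (Int.castRingHom R)).a₁ * (W.map (Int.castRingHom R)).translateX x₀ y₀ +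
            PowerSeries.C (W.map (Int.castRingHom R)).a₃) =
      Polynomial.aeval ((W.map (Int.castRingHom R)).translateX x₀ y₀ + PowerSeries.C (0 : R)) (Polynomial.derivative Pr) *
        (2 * (W.map (Int.castRingHom R)).translateY x₀ y₀ +
          PowerSeries.C (W.map (Int.castRingHom R)).a₁ * (W.map (Int.castRingHom R)).translateX x₀ y₀ +
          PowerSeries.C (W.map (Int.castRingHom R)).a₃))
    -- the arguments and their readings
    {Ω₁ u u' : ℂ} (hΩ₁ : Ω₁ ∉ L.lattice) (hαΩ₁ : ιc (j αR) * Ω₁ ∉ L.lattice) (hu : u ∉ L.lattice) (hu' : u' ∉ L.lattice)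
    (hw : Ω₁ + u' ∉ L.lattice) (hαw : ιc (j αR) * (Ω₁ + u') ∉ L.lattice) (hαu : ιc (j αR) * u' - u ∈ L.lattice)
    (hQ : QC.eval (℘[L] (Ω₁ + u')) ≠ 0)
    (hx₀ : ιc (j x₀) = ℘[L] Ω₁ - (W.baseChange ℂ).b₂ / 12)
    (hy₀ : ιc (j y₀) = (℘'[L] Ω₁ - (W.baseChange ℂ).a₁ * (℘[L] Ω₁ - (W.baseChange ℂ).b₂ / 12) - (W.baseChange ℂ).a₃) / 2)
    (hx₁ : ιc (j x₁) = ℘[L] (ιc (j αR) * Ω₁) - (W.baseChange ℂ).b₂ / 12)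
    (hy₁ : ιc (j y₁) = (℘'[L] (ιc (j αR) * Ω₁) - (W.baseChange ℂ).a₁ * (℘[L] (ιc (j αR) * Ω₁) - (W.baseChange ℂ).b₂ / 12) -
      (W.baseChange ℂ).a₃) / 2)
    {xu yu xu' yu' xw yw xz yz : Kb}
    (hxu : ιc xu = ℘[L] u - (W.baseChange ℂ).b₂ / 12)
    (hyu : ιc yu = (℘'[L] u - (W.baseChange ℂ).a₁ * (℘[L] u - (W.baseChange ℂ).b₂ / 12) - (W.baseChange ℂ).a₃) / 2)
    (hxu' : ιc xu' = ℘[L] u' - (W.baseChange ℂ).b₂ / 12)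
    (hyu' : ιc yu' = (℘'[L] u' - (W.baseChange ℂ).a₁ * (℘[L] u' - (W.baseChange ℂ).b₂ / 12) - (W.baseChange ℂ).a₃) / 2)
    (hxw : ιc xw = ℘[L] (Ω₁ + u') - (W.baseChange ℂ).b₂ / 12)
    (hyw : ιc yw = (℘'[L] (Ω₁ + u') - (W.baseChange ℂ).a₁ * (℘[L] (Ω₁ + u') - (W.baseChange ℂ).b₂ / 12) - (W.baseChange ℂ).a₃) / 2)
    (hxz : ιc xz = ℘[L] (ιc (j αR) * (Ω₁ + u')) - (W.baseChange ℂ).b₂ / 12)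
    (hyz : ιc yz = (℘'[L] (ιc (j αR) * (Ω₁ + u')) - (W.baseChange ℂ).a₁ * (℘[L] (ιc (j αR) * (Ω₁ + u')) - (W.baseChange ℂ).b₂ / 12) -
      (W.baseChange ℂ).a₃) / 2)
    {XU YU XU' YU' XW YW XZ YZ : M'} (hXU : ((XU : M') : AlgebraicClosure F) = ιv xu) (hYU : ((YU : M') : AlgebraicClosure F) = ιv yu)
    (hXU' : ((XU' : M') : AlgebraicClosure F) = ιv xu') (hYU' : ((YU' : M') : AlgebraicClosure F) = ιv yu')
    (hXW : ((XW : M') : AlgebraicClosure F) = ιv xw) (hYW : ((YW : M') : AlgebraicClosure F) = ιv yw)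
    (hXZ : ((XZ : M') : AlgebraicClosure F) = ιv xz) (hYZ : ((YZ : M') : AlgebraicClosure F) = ιv yz)
    {hnU : (curveOver M' ((W.map (Int.castRingHom ℤ_[p])).map ((LTCoeff.of F).toRingHom.comp e.symm.toRingHom))).toAffine.Nonsingular XU YU}
    {hnU' : (curveOver M' ((W.map (Int.castRingHom ℤ_[p])).map ((LTCoeff.of F).toRingHom.comp e.symm.toRingHom))).toAffine.Nonsingular XU' YU'}
    (hU : (.some XU YU hnU : (curveOver M' ((W.map (Int.castRingHom ℤ_[p])).map
        ((LTCoeff.of F).toRingHom.comp e.symm.toRingHom))).toAffine.Point) ∈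
      kernel (NormedField.valuation (K := M')) (curveOver M' ((W.map (Int.castRingHom ℤ_[p])).map ((LTCoeff.of F).toRingHom.comp e.symm.toRingHom))))
    (hU' : (.some XU' YU' hnU' : (curveOver M' ((W.map (Int.castRingHom ℤ_[p])).map
        ((LTCoeff.of F).toRingHom.comp e.symm.toRingHom))).toAffine.Point) ∈
      kernel (NormedField.valuation (K := M')) (curveOver M' ((W.map (Int.castRingHom ℤ_[p])).map ((LTCoeff.of F).toRingHom.comp e.symm.toRingHom))))
    (hs0 : (((ltSMul (maxNilIdeal F M') (isLTRing_LTCoeff hπ) (isLTSeries_map_LTCoeff_of_degree_one e hq he hP) c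
        (zPt (.some XU' YU' hnU') hU') : (maxNilIdeal F M').toIdeal) : unitBall M') : M') ≠ 0)
    (h2 : (2 : M') ≠ 0) :
    ltSMul (maxNilIdeal F M') (isLTRing_LTCoeff hπ) (isLTSeries_map_LTCoeff_of_degree_one e hq he hP) c
        (zPt (.some XU' YU' hnU') hU') =
      zPt (.some XU YU hnU) hU := by
  -- the two presentations share one integral model
  have hWR : (W.map (Int.castRingHom R)).map ψ =
      ((W.map (Int.castRingHom ℤ_[p])).map ((LTCoeff.of F).toRingHom.comp e.symm.toRingHom)).map
        (algebraMap (LTCoeff F) (unitBall M')) := by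
    rw [WeierstrassCurve.map_map (W.map (Int.castRingHom ℤ_[p]))]
    exact WeierstrassCurve.map_intCast_eq_map_intCast W _ _
  have hα0 : ιc (j αR) ≠ 0 := fun h => hαΩ₁ (by rw [h, zero_mul]; exact zero_mem _)
  -- nonsingularity of the points involved
  have h₀ := nonsingular_curveOver_of_readings e M' W ιc ιv L h₂ h₃ hΩ₁ hx₀ hy₀ (X := ((ψ x₀ : unitBall M') : M'))
    (Y := ((ψ y₀ : unitBall M') : M')) (hψj x₀) (hψj y₀)
  have h₁ := nonsingular_curveOver_of_readings e M' W ιc ιv L h₂ h₃ hαΩ₁ hx₁ hy₁ (X := ((ψ x₁ : unitBall M') : M'))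
    (Y := ((ψ y₁ : unitBall M') : M')) (hψj x₁) (hψj y₁)
  have hnW := nonsingular_curveOver_of_readings e M' W ιc ιv L h₂ h₃ hw hxw hyw hXW hYW
  have hnZ := nonsingular_curveOver_of_readings e M' W ιc ιv L h₂ h₃ hαw hxz hyz hXZ hYZ
  -- `P₁ + U′ = ξ(Ω₁ + u′)`
  have hsub : (.some XW YW hnW : (curveOver M' ((W.map (Int.castRingHom ℤ_[p])).map
      ((LTCoeff.of F).toRingHom.comp e.symm.toRingHom))).toAffine.Point) - .some XU' YU' hnU' = .some _ _ h₀ :=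
    some_sub_some_eq_some_curveOver_of_readings e M' W ιc ιv L h₂ h₃ hΩ₁ hu' hw rfl hx₀ hy₀ hxu' hyu' hxw hyw (hψj x₀) (hψj y₀)
      hXU' hYU' hXW hYW h₀ hnU' hnW
  have hsum : (.some _ _ h₀ : (curveOver M' ((W.map (Int.castRingHom ℤ_[p])).map
      ((LTCoeff.of F).toRingHom.comp e.symm.toRingHom))).toAffine.Point) + .some XU' YU' hnU' = .some XW YW hnW :=
    (sub_eq_iff_eq_add.mp hsub).symm
  -- the chart identities, `Q̂(X_W) ≠ 0`, `α ≠ 0`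
  obtain ⟨hZx, hZy⟩ := cmChart_of_readings M' ιc ιv ψ j hψj W L hT hQr hPr hw hαw hxw hyw hxz hyz hXW hYW hXZ hYZ
  have hQM := eval₂_ne_zero_of_readings M' ιc ιv ψ j hψj W L hs hQr hQ hxw hXW
  have hα : ((ψ αR : unitBall M') : M') ≠ 0 := by
    intro h0
    have h1 := congrArg (algebraMap M' (AlgebraicClosure F)) h0
    rw [map_zero, show algebraMap M' (AlgebraicClosure F) ((ψ αR : unitBall M') : M') = ιv (j αR) from hψj αR,
      map_eq_zero_iff ιv ιv.injective] at h1
    exact hα0 (by rw [h1, map_zero])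
  -- (CM-POINTS)(ii) on the lane curve, general scalar: `P([c] z(U′)) = ξ(α(Ω₁ + u′)) − ξ(αΩ₁)`
  have key := ptOfZ_ltSMul_eq_sub_of_cm_identities_of_hom M' (isLTRing_LTCoeff hπ) (isLTSeries_map_LTCoeff_of_degree_one e hq he hP)
    ((W.map (Int.castRingHom ℤ_[p])).map ((LTCoeff.of F).toRingHom.comp e.symm.toRingHom)) c ψ (W.map (Int.castRingHom R)) hWR
    hT0 hTP hidX hidY hU' h₀ h₁ hsum hnZ hQM hα h2 hZx hZy hs0
  -- `ξ(α(Ω₁ + u′)) − ξ(αΩ₁) = ξ(αu′) = ξ(u)`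
  have hq' : ιc (j αR) * u' ∉ L.lattice := fun h => hu (by
    have h' := sub_mem h hαu
    rwa [sub_sub_cancel] at h')
  have eq_u : ιc (j αR) * u' = u + ((⟨ιc (j αR) * u' - u, hαu⟩ : L.lattice) : ℂ) := by
    change ιc (j αR) * u' = u + (ιc (j αR) * u' - u); ring
  have hxq : ιc xu = ℘[L] (ιc (j αR) * u') - (W.baseChange ℂ).b₂ / 12 := by rw [hxu, eq_u, L.weierstrassP_add_coe]
  have hyq : ιc yu = (℘'[L] (ιc (j αR) * u') - (W.baseChange ℂ).a₁ * (℘[L] (ιc (j αR) * u') - (W.baseChange ℂ).b₂ / 12) -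
      (W.baseChange ℂ).a₃) / 2 := by rw [hyu, eq_u, L.weierstrassP_add_coe, L.derivWeierstrassP_add_coe]
  have hsub2 : (.some XZ YZ hnZ : (curveOver M' ((W.map (Int.castRingHom ℤ_[p])).map
      ((LTCoeff.of F).toRingHom.comp e.symm.toRingHom))).toAffine.Point) - .some _ _ h₁ = .some XU YU hnU :=
    some_sub_some_eq_some_curveOver_of_readings e M' W ιc ιv L h₂ h₃ hq' hαΩ₁ hαw (by ring) hxq hyq hx₁ hy₁ hxz hyz hXU hYU
      (hψj x₁) (hψj y₁) hXZ hYZ hnU h₁ hnZ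
  rw [hsub2] at key
  exact eq_zPt_of_ptOfZ_eq M' _ hU key

end Transport

/-! ## §3 The division points of two moduli differ by the CM action of `δ = μ′/μ` -/

section TwoLevels

variable {K : Type} [Field K] (ι : K →+* ℂ) {𝔪 𝔪' : Ideal (NumberField.RingOfIntegers K)} {L : PeriodPair} {Ω Ω' : ℂ}
  {β β' π₀ δ : NumberField.RingOfIntegers K}

open scoped NumberField in
/-- **`u_n(Ω) − ι(δ)·u_n(Ω′) ∈ L`**: for `L = Ω·ι(𝔪) = Ω′·ι(𝔪′)` with `𝔪′ ≤ 𝔪`, `Ω = ι(δ)·Ω′`, `βπ₀ − 1 ∈ 𝔪`, `β′π₀ − 1 ∈ 𝔪′`: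
`u_n(Ω) − ι(δ)u_n(Ω′) = ι(βⁿ − β′ⁿ)·Ω ∈ L` since `β ≡ β′ (mod 𝔪)` (`π₀` is invertible modulo `𝔪`).  So on the curve
`ξ(u_n(Ω)) = [δ]·ξ(u_n(Ω′))` — de Shalit's division points of two moduli are related by the CM action of `δ = μ′/μ`.
[cite: deShalit1987, II §4.4 (iv), II §4.9 (23)] -/
theorem divisionPt_sub_mul_divisionPt_mem (hL : ∀ z : ℂ, z ∈ L.lattice ↔ ∃ a ∈ 𝔪, z = Ω * ι (a : K))
    (hle : 𝔪' ≤ 𝔪) (hΩ : Ω = ι (δ : K) * Ω') (hβ : β * π₀ - 1 ∈ 𝔪) (hβ' : β' * π₀ - 1 ∈ 𝔪') (n : ℕ) :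
    (ι ((β ^ n : 𝓞 K) : K) * Ω - Ω / ι ((π₀ ^ n : 𝓞 K) : K)) -
        ι (δ : K) * (ι ((β' ^ n : 𝓞 K) : K) * Ω' - Ω' / ι ((π₀ ^ n : 𝓞 K) : K)) ∈ L.lattice := by
  -- `β ≡ β′ (mod 𝔪)`: `(β − β′)·βπ₀ ≡ β − β′` and `(β − β′)π₀ = (βπ₀ − 1) − (β′π₀ − 1) ∈ 𝔪`
  have hd : β - β' ∈ 𝔪 := by
    have h1 : (β - β') * π₀ ∈ 𝔪 := by
      have e : (β - β') * π₀ = (β * π₀ - 1) - (β' * π₀ - 1) := by ring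
      rw [e]; exact sub_mem hβ (hle hβ')
    have e2 : β - β' = (β - β') * (1 - β * π₀) + β * ((β - β') * π₀) := by ring
    rw [e2]
    refine add_mem ?_ (𝔪.mul_mem_left _ h1)
    have : (1 - β * π₀ : 𝓞 K) = -(β * π₀ - 1) := by ring
    rw [this, mul_neg]
    exact neg_mem (𝔪.mul_mem_left _ hβ)
  have hdn : β ^ n - β' ^ n ∈ 𝔪 := by
    obtain ⟨r, hr⟩ := sub_dvd_pow_sub_pow β β' n
    rw [hr]; exact 𝔪.mul_mem_right _ hd
  have e : (ι ((β ^ n : 𝓞 K) : K) * Ω - Ω / ι ((π₀ ^ n : 𝓞 K) : K)) -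
      ι (δ : K) * (ι ((β' ^ n : 𝓞 K) : K) * Ω' - Ω' / ι ((π₀ ^ n : 𝓞 K) : K)) = Ω * ι (((β ^ n - β' ^ n : 𝓞 K)) : K) := by
    rw [hΩ]; push_cast; simp only [map_sub, map_pow]; ring
  rw [e]
  exact (hL _).mpr ⟨_, hdn, rfl⟩

end TwoLevels

end Literature.NumberTheory.EllipticCurves

end
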